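import Mathlib.Analysis.Matrix.Order
import Literature.MathematicalPhysics.QuantumLattice.PairCorrelations
import HarnessLib

/-!
# The largest Rayleigh quotient of a Hermitian matrix is its largest eigenvalue:
# discharge of `Matrix.supRayleigh_eq_eigenvalues₀_zero`

Trunk T-QLATTICE, family `hubbard` (companion of
`Literature.MathematicalPhysics.QuantumLattice.PairCorrelations`, which defines
`Matrix.supRayleigh ρ = ⨆_{‖v‖ = 1} re ⟨v, ρ v⟩` and states the named facts
`Matrix.supRayleigh_eq_eigenvalues₀_zero` and `Matrix.rayleigh_le_supRayleigh`; this file only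
PROVES — it declares no definition and changes no statement).

## Contents

* `Matrix.IsHermitian.eigenvalues_le_eigenvalues₀_zero` — every eigenvalue of a Hermitian matrix
  is at most the first of Mathlib's decreasingly sorted `eigenvalues₀`.
* `Matrix.IsHermitian.le_algebraMap_eigenvalues₀_zero` — `ρ ≤ λ_max • 1` in the Loewner order
  (`MatrixOrder`).
* `Matrix.IsHermitian.re_dotProduct_mulVec_le` — the Rayleigh bound
  `re ⟨v, ρ v⟩ ≤ λ_max` for every unit vector `v` (Horn–Johnson, Theorem 4.2.2 (c)).
* `Matrix.IsHermitian.exists_re_dotProduct_mulVec_eq` — the bound is attained at a unit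
  eigenvector (a vector of Mathlib's `eigenvectorBasis`).
* `Matrix.supRayleigh_eq_eigenvalues₀_zero_holds : supRayleigh_eq_eigenvalues₀_zero` — the
  discharge: for Hermitian `ρ` on a nonempty index type, `ρ.supRayleigh = eigenvalues₀ 0`.
* `Matrix.re_dotProduct_mulVec_eq_half_add_conjTranspose`,
  `Matrix.rayleigh_le_supRayleigh_holds : rayleigh_le_supRayleigh` — for an ARBITRARY square
  complex matrix the unit-vector Rayleigh quotients `re ⟨v, ρ v⟩ = ½ re ⟨v, (ρ + ρᴴ) v⟩` are
  bounded (by `½ λ_max(ρ + ρᴴ)`), hence each is `≤ supRayleigh ρ` (a conditionally complete `⨆`).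

## Proof

Rayleigh–Ritz (Horn–Johnson, *Matrix Analysis*, 2nd ed., Theorem 4.2.2 (c), "Rayleigh":
`λ_max = max_{x ≠ 0} x*Ax / x*x`, attained exactly at the eigenvectors of `λ_max`). Upper bound:
the real spectrum of `ρ` is the range of `eigenvalues` (Mathlib
`Matrix.IsHermitian.spectrum_real_eq_range_eigenvalues`), each `≤ M := eigenvalues₀ 0`
(`eigenvalues₀_antitone`), so `ρ ≤ algebraMap M` in the continuous-functional-calculus order of
the C⋆-algebra `Matrix m m ℂ` (`le_algebraMap_iff_spectrum_le`, scoped `MatrixOrder`), i.e.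
`M • 1 - ρ` is positive semidefinite and `0 ≤ re ⟨v, (M • 1 - ρ) v⟩ = M - re ⟨v, ρ v⟩` for unit
`v`. Attainment: the `eigenvectorBasis` vector `b i` with `i ↔ 0` under
`Fintype.equivOfCardEq` is a unit vector with `re ⟨b i, ρ b i⟩ = eigenvalues i = eigenvalues₀ 0`
(Mathlib `Matrix.IsHermitian.eigenvalues_eq`). The `⨆` over the (nonempty, bounded) family of unit
vectors is then `M` (`ciSup_le`, `le_ciSup_of_le`). For a general `ρ`,
`⟨v, ρᴴ v⟩ = conj ⟨v, ρ v⟩` (`star_dotProduct`, `star_mulVec`, `dotProduct_mulVec`), so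
`re ⟨v, ρ v⟩ = ½ re ⟨v, (ρ + ρᴴ) v⟩` with `ρ + ρᴴ` Hermitian
(Mathlib `Matrix.isHermitian_add_transpose_self`; Horn–Johnson §4.1, (4.1.2), the Hermitian part),
which gives the bound needed for `le_ciSup`.

## Sources

R. A. Horn, C. R. Johnson, *Matrix Analysis*, 2nd ed. (CUP, 2013), §4.2, Theorem 4.2.2 (c)
(Rayleigh quotient theorem) [cite: HornJohnson2013, Thm 4.2.2(c)]; M. Reed, B. Simon, *Methods of
Modern Mathematical Physics IV*, Theorem XIII.1 (min–max) [cite: ReedSimonIV1978, Thm XIII.1];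
the physical use (`λ_max` of Yang's `ρ₂` as the ODLRO diagnostic): C. N. Yang, Rev. Mod. Phys.
34 (1962) 694, §4 [cite: Yang1962, §4]. All statements here are finite-dimensional linear
algebra.
-/

noncomputable section

open scoped ComplexOrder MatrixOrder InnerProductSpace

namespace Matrix

variable {m : Type*} [Fintype m]

section Hermitian

variable [DecidableEq m] {ρ : Matrix m m ℂ}

/-- Every eigenvalue of a Hermitian matrix is at most the first decreasingly sorted eigenvalue
`eigenvalues₀ 0` (`eigenvalues i = eigenvalues₀ (e.symm i)` by definition, and
`eigenvalues₀_antitone`). Horn–Johnson (2013), (4.2.1). [cite: HornJohnson2013, §4.2] -/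
theorem IsHermitian.eigenvalues_le_eigenvalues₀_zero (hρ : ρ.IsHermitian)
    (hm : 0 < Fintype.card m) (i : m) : hρ.eigenvalues i ≤ hρ.eigenvalues₀ ⟨0, hm⟩ :=
  hρ.eigenvalues₀_antitone (Fin.mk_le_of_le_val (Nat.zero_le _))

/-- `ρ ≤ λ_max • 1` in the Loewner order (`MatrixOrder`): the real spectrum of `ρ` is the range of
its eigenvalues, all `≤ λ_max = eigenvalues₀ 0`, and `ρ ≤ algebraMap r ↔ σ(ρ) ≤ r`
(`le_algebraMap_iff_spectrum_le`). Horn–Johnson (2013), Theorem 4.2.2. [cite: HornJohnson2013, Thm 4.2.2] -/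
theorem IsHermitian.le_algebraMap_eigenvalues₀_zero (hρ : ρ.IsHermitian)
    (hm : 0 < Fintype.card m) :
    ρ ≤ algebraMap ℝ (Matrix m m ℂ) (hρ.eigenvalues₀ ⟨0, hm⟩) := by
  rw [le_algebraMap_iff_spectrum_le (ha := hρ.isSelfAdjoint)]
  intro x hx
  rw [hρ.spectrum_real_eq_range_eigenvalues] at hx
  obtain ⟨i, rfl⟩ := hx
  exact hρ.eigenvalues_le_eigenvalues₀_zero hm i

/-- **Rayleigh bound.** For a Hermitian matrix and a unit vector `v`,
`re ⟨v, ρ v⟩ ≤ λ_max = eigenvalues₀ 0` (`λ_max • 1 - ρ` is positive semidefinite).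
Horn–Johnson (2013), Theorem 4.2.2 (c). [cite: HornJohnson2013, Thm 4.2.2(c)] -/
theorem IsHermitian.re_dotProduct_mulVec_le (hρ : ρ.IsHermitian) (hm : 0 < Fintype.card m)
    (v : m → ℂ) (hv : star v ⬝ᵥ v = 1) :
    (star v ⬝ᵥ (ρ *ᵥ v)).re ≤ hρ.eigenvalues₀ ⟨0, hm⟩ := by
  have h := (Matrix.le_iff.1 (hρ.le_algebraMap_eigenvalues₀_zero hm)).dotProduct_mulVec_nonneg v
  rw [sub_mulVec, dotProduct_sub, Algebra.algebraMap_eq_smul_one, smul_mulVec, one_mulVec,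
    dotProduct_smul, hv] at h
  obtain ⟨hre, -⟩ := Complex.nonneg_iff.mp h
  simp only [Complex.sub_re, Complex.real_smul, mul_one, Complex.ofReal_re] at hre
  linarith

/-- The vectors of Mathlib's orthonormal `eigenvectorBasis` are unit vectors in the `dotProduct`
language: `star (b i) ⬝ᵥ b i = 1`. [folklore] -/
theorem IsHermitian.star_eigenvectorBasis_dotProduct_self (hρ : ρ.IsHermitian) (i : m) :
    star (⇑(hρ.eigenvectorBasis i)) ⬝ᵥ ⇑(hρ.eigenvectorBasis i) = 1 := by
  rw [dotProduct_comm, ← EuclideanSpace.inner_eq_star_dotProduct, inner_self_eq_norm_sq_to_K,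
    hρ.eigenvectorBasis.orthonormal.1 i]
  simp

/-- **Attainment.** A Hermitian matrix on a nonempty index type has a unit vector (an
eigenvector for `λ_max`, namely the `eigenvectorBasis` vector indexed by the preimage of `0` under
`Fintype.equivOfCardEq`) whose Rayleigh quotient is `λ_max = eigenvalues₀ 0`
(Mathlib `Matrix.IsHermitian.eigenvalues_eq`). Horn–Johnson (2013), Theorem 4.2.2 (c).
[cite: HornJohnson2013, Thm 4.2.2(c)] -/
theorem IsHermitian.exists_re_dotProduct_mulVec_eq (hρ : ρ.IsHermitian)
    (hm : 0 < Fintype.card m) :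
    ∃ v : m → ℂ, star v ⬝ᵥ v = 1 ∧ (star v ⬝ᵥ (ρ *ᵥ v)).re = hρ.eigenvalues₀ ⟨0, hm⟩ := by
  set i : m := Fintype.equivOfCardEq (Fintype.card_fin _) ⟨0, hm⟩ with hi
  refine ⟨⇑(hρ.eigenvectorBasis i), hρ.star_eigenvectorBasis_dotProduct_self i, ?_⟩
  have h := hρ.eigenvalues_eq i
  rw [RCLike.re_to_complex] at h
  rw [← h]
  simp only [IsHermitian.eigenvalues, hi, Equiv.symm_apply_apply]

end Hermitian

/-- **Discharge of the named fact `supRayleigh_eq_eigenvalues₀_zero`** (Rayleigh–Ritz): for a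
Hermitian matrix on a nonempty index type, `supRayleigh ρ = ⨆_{‖v‖=1} re ⟨v, ρ v⟩` is the largest
eigenvalue `eigenvalues₀ 0` — every term is `≤ λ_max` (`IsHermitian.re_dotProduct_mulVec_le`) and
`λ_max` is attained at a unit eigenvector (`IsHermitian.exists_re_dotProduct_mulVec_eq`).
Horn–Johnson (2013), Theorem 4.2.2 (c); Reed–Simon IV, Theorem XIII.1; Yang, Rev. Mod. Phys. 34
(1962) 694, §4. [cite: HornJohnson2013, Thm 4.2.2(c)] -/
theorem supRayleigh_eq_eigenvalues₀_zero_holds : supRayleigh_eq_eigenvalues₀_zero (m := m) := by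
  intro _ ρ hρ hm
  obtain ⟨v₀, hv₀, hv₀eq⟩ := hρ.exists_re_dotProduct_mulVec_eq hm
  haveI : Nonempty {v : m → ℂ // star v ⬝ᵥ v = 1} := ⟨⟨v₀, hv₀⟩⟩
  have hbdd : BddAbove (Set.range fun v : {v : m → ℂ // star v ⬝ᵥ v = 1} =>
      (star v.1 ⬝ᵥ (ρ *ᵥ v.1)).re) := by
    refine ⟨hρ.eigenvalues₀ ⟨0, hm⟩, ?_⟩
    rintro _ ⟨v, rfl⟩
    exact hρ.re_dotProduct_mulVec_le hm v.1 v.2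
  rw [supRayleigh]
  refine le_antisymm (ciSup_le fun v => hρ.re_dotProduct_mulVec_le hm v.1 v.2) ?_
  exact le_ciSup_of_le hbdd ⟨v₀, hv₀⟩ hv₀eq.ge

/-! ### Boundedness of Rayleigh quotients of an arbitrary matrix; `rayleigh_le_supRayleigh` -/

/-- `⟨v, ρᴴ v⟩ = conj ⟨v, ρ v⟩` in the `dotProduct` language. [folklore] -/
theorem star_dotProduct_conjTranspose_mulVec (ρ : Matrix m m ℂ) (v : m → ℂ) :
    star v ⬝ᵥ (ρᴴ *ᵥ v) = star (star v ⬝ᵥ (ρ *ᵥ v)) := by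
  rw [← star_dotProduct_star, star_mulVec, star_star, ← dotProduct_mulVec]

/-- The real part of a Rayleigh quotient only sees the Hermitian part `H(ρ) = ½ (ρ + ρᴴ)` of the
Toeplitz decomposition: `re ⟨v, ρ v⟩ = ½ re ⟨v, (ρ + ρᴴ) v⟩`, because `⟨v, ρᴴ v⟩ = conj ⟨v, ρ v⟩`.
Horn–Johnson (2013), §4.1, (4.1.2) (Toeplitz decomposition). [cite: HornJohnson2013, §4.1 (4.1.2)] -/
theorem re_dotProduct_mulVec_eq_half_add_conjTranspose (ρ : Matrix m m ℂ) (v : m → ℂ) :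
    (star v ⬝ᵥ (ρ *ᵥ v)).re = (1 / 2 : ℝ) * (star v ⬝ᵥ ((ρ + ρᴴ) *ᵥ v)).re := by
  rw [add_mulVec, dotProduct_add, Complex.add_re, star_dotProduct_conjTranspose_mulVec,
    Complex.star_def, Complex.conj_re]
  ring

/-- The unit-vector Rayleigh quotients of an arbitrary square complex matrix are bounded above
(by `½ λ_max(ρ + ρᴴ)`: `re_dotProduct_mulVec_eq_half_add_conjTranspose` and the Rayleigh bound
`IsHermitian.re_dotProduct_mulVec_le` for the Hermitian matrix `ρ + ρᴴ`; bound `0` on an empty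
index type, where there is no unit vector). Horn–Johnson (2013), Theorem 4.2.2 (c) and §4.1,
(4.1.2). [cite: HornJohnson2013, Thm 4.2.2(c)] -/
theorem bddAbove_range_re_dotProduct_mulVec (ρ : Matrix m m ℂ) :
    BddAbove (Set.range fun v : {v : m → ℂ // star v ⬝ᵥ v = 1} =>
      (star v.1 ⬝ᵥ (ρ *ᵥ v.1)).re) := by
  classical
  rcases isEmpty_or_nonempty m with hm | hm
  · refine ⟨0, ?_⟩
    rintro _ ⟨v, rfl⟩
    have h := v.2
    simp [dotProduct] at h
  · have hcard : 0 < Fintype.card m := Fintype.card_pos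
    refine ⟨(1 / 2 : ℝ) * (isHermitian_add_transpose_self ρ).eigenvalues₀ ⟨0, hcard⟩, ?_⟩
    rintro _ ⟨v, rfl⟩
    dsimp only
    rw [re_dotProduct_mulVec_eq_half_add_conjTranspose]
    exact mul_le_mul_of_nonneg_left
      ((isHermitian_add_transpose_self ρ).re_dotProduct_mulVec_le hcard v.1 v.2)
      (by norm_num)

/-- **Discharge of the named fact `rayleigh_le_supRayleigh`**: every unit-vector Rayleigh quotient
`re ⟨v, ρ v⟩` is at most `supRayleigh ρ` (`le_ciSup` for the bounded family,
`bddAbove_range_re_dotProduct_mulVec`). Horn–Johnson (2013), Theorem 4.2.2 (c); Yang, Rev. Mod.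
Phys. 34 (1962) 694, §4. [cite: HornJohnson2013, Thm 4.2.2(c)] -/
private theorem rayleigh_le_supRayleigh_holds : rayleigh_le_supRayleigh (m := m) := by
  intro ρ v hv
  rw [supRayleigh]
  exact le_ciSup_of_le (bddAbove_range_re_dotProduct_mulVec ρ) ⟨v, hv⟩ le_rfl

end Matrix
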